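import Mathlib
import Summits.AtomisticToContinuum.HydrodynamicLimit.Theorems.InformationPercolationEngineKickFairRelEquilibriumMesoConditionThePastDefs
import Summits.AtomisticToContinuum.HydrodynamicLimit.Theorems.InformationPercolationEngineKickFairRelEquilibriumMesoTransferAE
import Summits.AtomisticToContinuum.HydrodynamicLimit.Theorems.InformationPercolationEngineKickFairRelEquilibriumMesoTransferSlots
import Summits.AtomisticToContinuum.HydrodynamicLimit.Theorems.InformationPercolationEngineKickFairRelEquilibriumMesoPastMeasurable
import Summits.AtomisticToContinuum.HydrodynamicLimit.Theorems.InformationPercolationEngineKickFairRelEquilibriumMesoReductionA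
import Summits.AtomisticToContinuum.HydrodynamicLimit.Theorems.InformationPercolationEngineKickFairRelEquilibriumMesoSingleKickBiasNecessary
import Summits.AtomisticToContinuum.HydrodynamicLimit.Theorems.KickFairRelEquilibriumMeso.Negative.WindowAlgebra
import Literature.MathematicalPhysics.KineticTheory.LocalGibbsConstEquivalence
import HarnessLib

/-!
# `KickFairRelEquilibriumMeso`, line `condition-the-past` — NECESSITY of TF:
# `truncatedFluctuation_of_mesoBody : MesoBody rs → TruncatedFluctuation rs`

Prover file (`--supports stmt-AtomisticToContinuum-15177`) for the registered sub-goal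
`truncatedFluctuation_of_mesoBody` (wave 2, lead c7) of the checked skeleton
`Cruxes/KickFairRelEquilibriumMeso/Lines/condition_the_past.lean` of the crux
`Summit.AtomisticToContinuum.HydrodynamicLimit.Theses.InformationPercolationEngine.KickFairRelEquilibriumMeso`.
It certifies in Lean that the index-truncated, `β`-centred fluctuation statement TF (`TruncatedFluctuation rs`)
is IMPLIED by the body of the crux along the same cell sequence (`MesoBody rs`). Together with the landed
necessity of B1 (`singleKickBias_of_mesoBody`) and the reduction `stub_reductionA : B1 → CT-a → TF → MesoBody rs`,
the crux body is thus EQUIVALENT to `B1 ∧ TF` modulo the count debt CT-a.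

Argument (fixed `N`, `c = ε/(N+1)`, `I_n = 1_{n < A(N+1)^{1/3}}`, `D = kickDev`, `β = betaLG`). The truncated weight
`h' := I · h` is admissible (measurable, `|h'| ≤ 1`) and POINTWISE
`fullSum h' = c ΣΣ (I h) D`, so `TF-sum_h = c ΣΣ I h (D − β) = fullSum h' − c ΣΣ I h β`, whence
`|TF-sum_h| ≤ |fullSum h'| + c ΣΣ |β|` (`abs_truncFluct_le`; no a.e. argument). Integrating in the
`∫⁻ … ENNReal.ofReal` currency (`lintegral_add_right'`, the B1 integrand being a.e.-measurable by
`aemeasurable_biasFn`): `E|TF| ≤ E|fullSum h'| + E[c ΣΣ |β|]` (`lintegral_truncFluct_le`), and the two terms are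
`≤ δ/2` eventually by the body of the crux at `h'` (`KickBoundRel … = ∫⁻ ofReal |fullSum …| ≤ ofReal δ`
definitionally) and by B1 (`singleKickBias_of_mesoBody`). Bookkeeping: `σ₀ := min σ₁ σ₂`, `N₀ := max N₁ N₂`.
-/

noncomputable section

open MeasureTheory Set Filter Topology
open scoped ENNReal Classical

namespace Summit.AtomisticToContinuum.HydrodynamicLimit.Theorems.KickFairRelEquilibriumMesoLine

open Literature.Analysis.FluidPDE Literature.MathematicalPhysics.KineticTheory
open Summit.AtomisticToContinuum.HydrodynamicLimit.Theorems.KickFairRelEquilibriumMesoNegative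
  (KickBoundRel MesoBody)

variable {σ : ℝ} {N : ℕ}

/-! ## An elementary inequality -/

/-- **Pointwise splitting of the truncated, centred, weighted double sum**: for `0 ≤ c`, `|w| ≤ 1`, `|I| ≤ 1`,
`|c ΣΣ I (w (D − β))| ≤ |c ΣΣ (I w) D| + c ΣΣ |β|`. [folklore] -/
theorem abs_truncFluct_le {ι : Type*} (s : Finset ι) (K : ι → ℕ) (w D β : ι → ℕ → ℝ) (I : ℕ → ℝ)
    {c : ℝ} (hc : 0 ≤ c) (hw : ∀ i n, |w i n| ≤ 1) (hI : ∀ n, |I n| ≤ 1) :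
    |c * ∑ i ∈ s, ∑ n ∈ Finset.range (K i), I n * (w i n * (D i n - β i n))| ≤
      |c * ∑ i ∈ s, ∑ n ∈ Finset.range (K i), I n * w i n * D i n| +
      c * ∑ i ∈ s, ∑ n ∈ Finset.range (K i), |β i n| := by
  -- the decomposition `I (w (D − β)) = (I w) D − (I w) β`
  have hdec : c * ∑ i ∈ s, ∑ n ∈ Finset.range (K i), I n * (w i n * (D i n - β i n)) =
      c * ∑ i ∈ s, ∑ n ∈ Finset.range (K i), I n * w i n * D i n -
      c * ∑ i ∈ s, ∑ n ∈ Finset.range (K i), I n * w i n * β i n := by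
    rw [← mul_sub, ← Finset.sum_sub_distrib]
    congr 1
    refine Finset.sum_congr rfl fun i _ => ?_
    rw [← Finset.sum_sub_distrib]
    refine Finset.sum_congr rfl fun n _ => ?_
    ring
  rw [hdec]
  refine (abs_sub _ _).trans (add_le_add le_rfl ?_)
  -- `|c ΣΣ (I w) β| ≤ c ΣΣ |β|`
  rw [abs_mul, abs_of_nonneg hc]
  refine mul_le_mul_of_nonneg_left ?_ hc
  refine (Finset.abs_sum_le_sum_abs _ _).trans (Finset.sum_le_sum fun i _ => ?_)
  refine (Finset.abs_sum_le_sum_abs _ _).trans (Finset.sum_le_sum fun n _ => ?_)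
  rw [abs_mul, abs_mul]
  calc |I n| * |w i n| * |β i n| ≤ 1 * 1 * |β i n| :=
        mul_le_mul_of_nonneg_right (mul_le_mul (hI n) (hw i n) (abs_nonneg _) zero_le_one) (abs_nonneg _)
    _ = |β i n| := by ring

/-! ## The estimate at fixed `N` -/

/-- **The `L¹(LG)` splitting of the TF integrand at fixed `N`** (`0 < σ`, `|h| ≤ 1`, any level `a`): with the
truncated weight `h' := 1_{n<a} · h`,
`E_{LG}|(ε/(N+1)) ΣΣ 1_{n<a} h (D − β)| ≤ E_{LG}|S_{h'}| + E_{LG}[(ε/(N+1)) ΣΣ |β|]`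
in the `∫⁻ … ENNReal.ofReal` currency (pointwise `abs_truncFluct_le`, `fullSum h' = (ε/(N+1)) ΣΣ (1_{n<a} h) D`
definitionally, `lintegral_add_right'` with the a.e.-measurable B1 integrand `aemeasurable_biasFn`). [folklore] -/
theorem lintegral_truncFluct_le (hσ : 0 < σ) (Φ : Flow σ N) (a₀ θ₀ : T3 → ℝ) (u₀ : T3 → V3) (τ r : ℝ)
    (g : V3 × V3 × V3 → ℝ) {h : Fin (N + 1) → ℕ → Past N → ℝ} (hhb : ∀ i n p, |h i n p| ≤ 1) (a : ℝ) :
    ∫⁻ z, ENNReal.ofReal |hsDiameter σ N / ((N : ℝ) + 1) *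
        ∑ i : Fin (N + 1), ∑ n ∈ Finset.range (cnt Φ τ z i),
          (if (n : ℝ) < a then (1 : ℝ) else 0) *
            (h i n (past Φ r z i n) * (kickDev Φ r g i n z - betaLG σ a₀ θ₀ u₀ Φ r g i n z))|
        ∂(localGibbsLaw σ a₀ u₀ θ₀ N Φ) ≤
      ∫⁻ z, ENNReal.ofReal |fullSum Φ τ r g
          (fun i n p => (if (n : ℝ) < a then (1 : ℝ) else 0) * h i n p) z| ∂(localGibbsLaw σ a₀ u₀ θ₀ N Φ) +
      ∫⁻ z, ENNReal.ofReal (hsDiameter σ N / ((N : ℝ) + 1) *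
          ∑ i : Fin (N + 1), ∑ n ∈ Finset.range (cnt Φ τ z i), |betaLG σ a₀ θ₀ u₀ Φ r g i n z|)
        ∂(localGibbsLaw σ a₀ u₀ θ₀ N Φ) := by
  have hc0 : 0 ≤ hsDiameter σ N / ((N : ℝ) + 1) := div_nonneg (hsDiameter_pos hσ N).le (by positivity)
  -- the B1 integrand is nonnegative
  have hP1nn : ∀ z : Phase N, 0 ≤ hsDiameter σ N / ((N : ℝ) + 1) *
      ∑ i : Fin (N + 1), ∑ n ∈ Finset.range (cnt Φ τ z i), |betaLG σ a₀ θ₀ u₀ Φ r g i n z| := fun z =>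
    mul_nonneg hc0 (Finset.sum_nonneg fun i _ => Finset.sum_nonneg fun n _ => abs_nonneg _)
  -- the pointwise splitting (everywhere)
  have hpt : ∀ z : Phase N, ENNReal.ofReal |hsDiameter σ N / ((N : ℝ) + 1) *
        ∑ i : Fin (N + 1), ∑ n ∈ Finset.range (cnt Φ τ z i),
          (if (n : ℝ) < a then (1 : ℝ) else 0) *
            (h i n (past Φ r z i n) * (kickDev Φ r g i n z - betaLG σ a₀ θ₀ u₀ Φ r g i n z))| ≤
      ENNReal.ofReal |fullSum Φ τ r g (fun i n p => (if (n : ℝ) < a then (1 : ℝ) else 0) * h i n p) z| +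
      ENNReal.ofReal (hsDiameter σ N / ((N : ℝ) + 1) *
          ∑ i : Fin (N + 1), ∑ n ∈ Finset.range (cnt Φ τ z i), |betaLG σ a₀ θ₀ u₀ Φ r g i n z|) := by
    intro z
    have key := abs_truncFluct_le Finset.univ (cnt Φ τ z) (fun i n => h i n (past Φ r z i n))
      (fun i n => kickDev Φ r g i n z) (fun i n => betaLG σ a₀ θ₀ u₀ Φ r g i n z)
      (fun n => if (n : ℝ) < a then (1 : ℝ) else 0) hc0 (fun i n => hhb i n _)
      (fun n => by split_ifs <;> simp)
    -- `fullSum h' = c ΣΣ (1_{n<a} h) D` definitionally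
    have hfs : hsDiameter σ N / ((N : ℝ) + 1) * ∑ i : Fin (N + 1), ∑ n ∈ Finset.range (cnt Φ τ z i),
        (if (n : ℝ) < a then (1 : ℝ) else 0) * h i n (past Φ r z i n) * kickDev Φ r g i n z =
        fullSum Φ τ r g (fun i n p => (if (n : ℝ) < a then (1 : ℝ) else 0) * h i n p) z := rfl
    rw [hfs] at key
    rw [← ENNReal.ofReal_add (abs_nonneg _) (hP1nn z)]
    exact ENNReal.ofReal_le_ofReal key
  calc ∫⁻ z, ENNReal.ofReal |hsDiameter σ N / ((N : ℝ) + 1) *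
          ∑ i : Fin (N + 1), ∑ n ∈ Finset.range (cnt Φ τ z i),
            (if (n : ℝ) < a then (1 : ℝ) else 0) *
              (h i n (past Φ r z i n) * (kickDev Φ r g i n z - betaLG σ a₀ θ₀ u₀ Φ r g i n z))|
          ∂(localGibbsLaw σ a₀ u₀ θ₀ N Φ)
      ≤ ∫⁻ z, ENNReal.ofReal |fullSum Φ τ r g
            (fun i n p => (if (n : ℝ) < a then (1 : ℝ) else 0) * h i n p) z| +
          ENNReal.ofReal (hsDiameter σ N / ((N : ℝ) + 1) *
            ∑ i : Fin (N + 1), ∑ n ∈ Finset.range (cnt Φ τ z i), |betaLG σ a₀ θ₀ u₀ Φ r g i n z|)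
          ∂(localGibbsLaw σ a₀ u₀ θ₀ N Φ) := lintegral_mono fun z => hpt z
    _ = _ := lintegral_add_right' _ (aemeasurable_biasFn hσ Φ a₀ θ₀ u₀ τ r g)

/-! ## The registered sub-goal -/

/-- **NECESSITY OF TF — `truncatedFluctuation_of_mesoBody` (registered sub-goal of the line `condition-the-past`).**
The body of the crux along the cell sequence `rs` (`MesoBody rs`: `E_{LG}|S_h| ≤ δ` eventually in `N`, uniformly over
measurable weights `|h| ≤ 1` of the typed past) implies the truncated fluctuation statement TF
(`TruncatedFluctuation rs`: `E_{LG}|(ε/(N+1)) Σ_i Σ_{n<cnt_i} 1_{n<A(N+1)^{1/3}} h (D − β)| ≤ δ` eventually, uniformly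
over the same weights): test the body with the admissible truncated weight `h' = 1_{n<A(N+1)^{1/3}} · h` at `δ/2`
and subtract the single-kick bias, controlled by B1 (`singleKickBias_of_mesoBody`) at `δ/2`
(`lintegral_truncFluct_le`; `σ₀ := min σ₁ σ₂`, `N₀ := max N₁ N₂`). [folklore] -/
theorem truncatedFluctuation_of_mesoBody : MesoBody rs → TruncatedFluctuation rs := by
  intro hMB a₀ θ₀ u₀ ha hθ hu ha0 hθ0
  obtain ⟨σ₁, hσ₁, H1⟩ := hMB a₀ θ₀ u₀ ha hθ hu ha0 hθ0
  obtain ⟨σ₂, hσ₂, H2⟩ := singleKickBias_of_mesoBody hMB a₀ θ₀ u₀ ha hθ hu ha0 hθ0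
  refine ⟨min σ₁ σ₂, lt_min hσ₁ hσ₂, ?_⟩
  intro σ hσ hσlt Φ τ hτ g hg hgb A _ δ hδ
  have hσ1 : σ < σ₁ := hσlt.trans_le (min_le_left _ _)
  have hσ2 : σ < σ₂ := hσlt.trans_le (min_le_right _ _)
  obtain ⟨C, hC⟩ := hgb
  obtain ⟨N₁, hN₁⟩ := H1 σ hσ hσ1 Φ τ hτ g hg ⟨C, hC⟩ (δ / 2) (by positivity)
  obtain ⟨N₂, hN₂⟩ := H2 σ hσ hσ2 Φ τ hτ g hg ⟨C, hC⟩ (δ / 2) (by positivity)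
  refine ⟨max N₁ N₂, fun N hN h hhm hhb => ?_⟩
  have hN1 : N₁ ≤ N := (le_max_left _ _).trans hN
  have hN2 : N₂ ≤ N := (le_max_right _ _).trans hN
  -- the admissible truncated weight `h' = 1_{n < A(N+1)^{1/3}} · h`
  have hwm : ∀ (i : Fin (N + 1)) (n : ℕ), Measurable fun p : Past N =>
      (if (n : ℝ) < A * ((N : ℝ) + 1) ^ (1 / 3 : ℝ) then (1 : ℝ) else 0) * h i n p :=
    fun i n => (hhm i n).const_mul _
  have hwb : ∀ (i : Fin (N + 1)) (n : ℕ) (p : Past N),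
      |(if (n : ℝ) < A * ((N : ℝ) + 1) ^ (1 / 3 : ℝ) then (1 : ℝ) else 0) * h i n p| ≤ 1 := by
    intro i n p
    rw [abs_mul]
    calc |(if (n : ℝ) < A * ((N : ℝ) + 1) ^ (1 / 3 : ℝ) then (1 : ℝ) else 0)| * |h i n p| ≤ 1 * 1 :=
          mul_le_mul (by split_ifs <;> simp) (hhb i n p) (abs_nonneg _) zero_le_one
      _ = 1 := one_mul 1
  -- the body of the crux at `h'`, and B1
  have hK := hN₁ N hN1 (fun i n p => (if (n : ℝ) < A * ((N : ℝ) + 1) ^ (1 / 3 : ℝ) then (1 : ℝ) else 0) * h i n p)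
    hwm hwb
  change ∫⁻ z, ENNReal.ofReal |fullSum (Φ N) τ (rs N) g
      (fun i n p => (if (n : ℝ) < A * ((N : ℝ) + 1) ^ (1 / 3 : ℝ) then (1 : ℝ) else 0) * h i n p) z|
      ∂(localGibbsLaw σ a₀ u₀ θ₀ N (Φ N)) ≤ ENNReal.ofReal (δ / 2) at hK
  have hB := hN₂ N hN2
  calc _ ≤ _ := lintegral_truncFluct_le hσ (Φ N) a₀ θ₀ u₀ τ (rs N) g hhb (A * ((N : ℝ) + 1) ^ (1 / 3 : ℝ))
    _ ≤ ENNReal.ofReal (δ / 2) + ENNReal.ofReal (δ / 2) := add_le_add hK hB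
    _ = ENNReal.ofReal δ := by
        rw [← ENNReal.ofReal_add (by positivity) (by positivity), add_halves]

end Summit.AtomisticToContinuum.HydrodynamicLimit.Theorems.KickFairRelEquilibriumMesoLine

end
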